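import Summits.NavierStokesRegularity.NavierStokesRegularity.Theorems.ClockStretchingLawClockCeilingOpenSetVorticityLiouville
import Summits.NavierStokesRegularity.NavierStokesRegularity.Theorems.SqueezeCycleSingularZoomExtraction
import Summits.NavierStokesRegularity.NavierStokesRegularity.Theorems.SqueezeCycleExtremalElementExistsRescale
import Literature.Analysis.FluidPDE.TypeIAncientMild
import HarnessLib

/-!
# Route ClockStretchingLaw, crux `ClockCeiling` (stmt-NavierStokesRegularity-10570), line `registered` —
# dynamical structural law: BACKWARD PERSISTENCE OF VELOCITY CONCENTRATION in the Type-I ancient mild class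

`stub_backwardPersistenceOfConcentration`: for every Type-I constant `C`, every level `θ > 0` and
every fixed time ratio `L ≥ 1` there are `R = R(C, θ, L) > 0` and `θ' = θ'(C, θ, L) > 0` such that
for every element `u` of the Type-I ancient mild class `A_C` (`IsTypeIAncientMild C u`: jointly
smooth on `t < 0`, divergence free, KNSS/Oseen mild between all pairs `s < t < 0`,
`‖u(t,x)‖ ≤ C/√(−t)`), every `t < 0` and every `x`: if `√(−t)‖u(t, x)‖ ≥ θ` then at the EARLIER
time `L t` there is a point `x'` within `R√(−t)` of `x` with `√(−L t)‖u(L t, x')‖ ≥ θ'` —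
velocity concentration cannot appear from nowhere.

## Proof (contradiction + zoom + compactness + a zero slice kills a class element)

If not, for every `k` there are `u_k ∈ A_C`, `t_k < 0`, `x_k` with `√(−t_k)‖u_k(t_k, x_k)‖ ≥ θ`
but `√(−L t_k)‖u_k(L t_k, x')‖ < 1/(k+1)` for all `x'` in the ball of radius `(k+1)√(−t_k)` about
`x_k`. The Navier–Stokes zoom `v_k(s, y) = c_k u_k(c_k² s, x_k + c_k y)`, `c_k = √(−t_k)`, lies in
`A_C` (`isTypeIAncientMild_zoom`) with `‖v_k(−1, 0)‖ = √(−t_k)‖u_k(t_k, x_k)‖ ≥ θ` and, for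
`‖y‖ < k + 1`, `‖v_k(−L, y)‖ = √(−t_k)‖u_k(L t_k, x_k + c_k y)‖ ≤ √(−L t_k)‖u_k(L t_k, ·)‖ < 1/(k+1)`
(`√(−L t_k) = √L · c_k ≥ c_k` as `L ≥ 1`). KNSS compactness of the class on growing windows
(`exists_tendsto_of_typeI_seq_Ioo`) extracts a limit `W ∈ A_C` with pointwise convergence of values
at every `t < 0`: `‖W(−1, 0)‖ ≥ θ > 0` while `W(−L, ·) ≡ 0` (every `y` is eventually inside the
growing balls). One constant slice kills a class element (`sliceConstLiouville` with `b = 0`,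
KNSS 2009 Remark 6.1 + uniqueness/analyticity in time): `W ≡ 0` on `t < 0` — contradiction.

## References

* G. Koch, N. Nadirashvili, G. Seregin, V. Šverák, *Liouville theorems for the Navier–Stokes
  equations and applications*, Acta Math. 203 (2009) 83–105 = arXiv:0709.3599, §1 (1.2),
  Prop. 4.1, Remark 6.1. [KochNadirashviliSereginSverak2009]
-/

noncomputable section

-- the summit and its single sub-problem share the name (CONVENTIONS §1), as in every Theorems file
set_option linter.dupNamespace false

namespace Summit.NavierStokesRegularity.NavierStokesRegularity.Theorems

open MeasureTheory Set Function Filter Topology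
open Literature.Analysis Literature.Analysis.FluidPDE

section BackwardPersistenceOfConcentration

variable {C : ℝ} {u : ℝ → EuclideanSpace ℝ (Fin 3) → EuclideanSpace ℝ (Fin 3)}

/-- **The Navier–Stokes zoom to unit scale, read at the two times `−1` and `−L`.** For `u ∈ A_C`,
`t < 0` and a centre `x`, the zoom `v(s, y) = c u(c² s, x + c y)`, `c = √(−t)`, is an element of
`A_C` (`isTypeIAncientMild_zoom`, KNSS 2009 §1 (1.2)) with `‖v(−1, 0)‖ = √(−t)‖u(t, x)‖` and
`‖v(−L, y)‖ = √(−t)‖u(L t, x + c y)‖` for every `y`.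
[cite: KochNadirashviliSereginSverak2009, §1 (1.2) (arXiv:0709.3599 p. 2)] -/
theorem backwardPersistence_zoom (hu : IsTypeIAncientMild C u) {t : ℝ} (ht : t < 0)
    (x : EuclideanSpace ℝ (Fin 3)) (L : ℝ) :
    ∃ v : ℝ → EuclideanSpace ℝ (Fin 3) → EuclideanSpace ℝ (Fin 3), IsTypeIAncientMild C v ∧
      ‖v (-1) 0‖ = Real.sqrt (-t) * ‖u t x‖ ∧
      ∀ y, ‖v (-L) y‖ = Real.sqrt (-t) * ‖u (L * t) (x + Real.sqrt (-t) • y)‖ := by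
  set c : ℝ := Real.sqrt (-t) with hcdef
  have hc : 0 < c := Real.sqrt_pos.2 (neg_pos.2 ht)
  have hc2 : c ^ 2 = -t := Real.sq_sqrt (neg_pos.2 ht).le
  have ht1 : 0 + c ^ 2 * (-1) = t := by rw [hc2]; ring
  have htL : 0 + c ^ 2 * (-L) = L * t := by rw [hc2]; ring
  refine ⟨c • stPull (c ^ 2) c 0 x u, isTypeIAncientMild_zoom hu hc x, ?_, fun y => ?_⟩
  · show ‖c • u (0 + c ^ 2 * (-1)) (x + c • (0 : EuclideanSpace ℝ (Fin 3)))‖ = c * ‖u t x‖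
    rw [ht1, smul_zero, add_zero, norm_smul, Real.norm_of_nonneg hc.le]
  · show ‖c • u (0 + c ^ 2 * (-L)) (x + c • y)‖ = c * ‖u (L * t) (x + c • y)‖
    rw [htL, norm_smul, Real.norm_of_nonneg hc.le]

/-- **Backward persistence of velocity concentration in the Type-I ancient mild class.** For every
`C`, `θ > 0` and `L ≥ 1` there are `R > 0` and `θ' > 0` such that for every `u ∈ A_C`, `t < 0`,
`x` with `√(−t)‖u(t, x)‖ ≥ θ` there is `x' ∈ B(x, R√(−t))` with `√(−L t)‖u(L t, x')‖ ≥ θ'`. By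
contradiction: zoom the bad configurations to unit scale (`backwardPersistence_zoom`), extract a
limit in the class (`exists_tendsto_of_typeI_seq_Ioo`) which has `‖W(−1, 0)‖ ≥ θ` but a ZERO slice
at time `−L`, against `sliceConstLiouville`.
[cite: KochNadirashviliSereginSverak2009, Prop. 4.1 and Remark 6.1 (arXiv:0709.3599)] -/
theorem backwardPersistenceOfConcentration (C θ L : ℝ) (hθ : 0 < θ) (hL : 1 ≤ L) :
    ∃ R > 0, ∃ θ' > 0, ∀ u : ℝ → EuclideanSpace ℝ (Fin 3) → EuclideanSpace ℝ (Fin 3),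
      IsTypeIAncientMild C u → ∀ t < 0, ∀ x : EuclideanSpace ℝ (Fin 3),
        θ ≤ Real.sqrt (-t) * ‖u t x‖ →
          ∃ x' ∈ Metric.ball x (R * Real.sqrt (-t)),
            θ' ≤ Real.sqrt (-(L * t)) * ‖u (L * t) x'‖ := by
  by_contra h
  push Not at h
  have hL0 : 0 < L := one_pos.trans_le hL
  -- bad configurations: concentration `≥ θ` at `(t, x)`, but `< 1/(n+1)` at time `L t` on the ball
  -- of radius `(n+1)√(-t)` about `x`
  have hseq : ∀ n : ℕ, ∃ u : ℝ → EuclideanSpace ℝ (Fin 3) → EuclideanSpace ℝ (Fin 3),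
      IsTypeIAncientMild C u ∧ ∃ t < 0, ∃ x : EuclideanSpace ℝ (Fin 3),
        θ ≤ Real.sqrt (-t) * ‖u t x‖ ∧
          ∀ x' ∈ Metric.ball x (((n : ℝ) + 1) * Real.sqrt (-t)),
            Real.sqrt (-(L * t)) * ‖u (L * t) x'‖ < 1 / ((n : ℝ) + 1) := fun n =>
    h _ (by positivity) _ Nat.one_div_pos_of_nat
  choose u hu t ht x hx hsmall using hseq
  -- zoom to unit scale around the concentration points
  choose v hv hv0 hvL using fun n => backwardPersistence_zoom (hu n) (ht n) (x n) L
  -- compactness on the growing windows `(-(k+1), 0)`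
  set A : ℕ → ℝ := fun k => -((k : ℝ) + 1)
  have hAt : Tendsto A atTop atBot :=
    tendsto_neg_atTop_atBot.comp (tendsto_natCast_atTop_atTop.atTop_add tendsto_const_nhds)
  have hcont : ∀ k, ContinuousOn (uncurry (v k)) (Ioo (A k) 0 ×ˢ univ) := fun k =>
    (hv k).continuousOn_uncurry.mono (prod_mono (fun t ht => ht.2) subset_rfl)
  have hdivw : ∀ k, ∀ t ∈ Ioo (A k) 0, IsWeaklyDivFree (v k t) := fun k t ht =>
    (hv k).isWeaklyDivFree ht.2
  have hmild : ∀ k, ∀ s t : ℝ, A k < s → s < t → t < 0 → ∀ x,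
      v k t x = UnboundedOperators.heatExtension (v k s) (t - s) x -
        oseenDuhamel 1 s (v k) (v k) t x :=
    fun k s t _ hst ht x => (hv k).mild_eq_heatExtension hst ht x
  have hI : ∀ k, ∀ t ∈ Ioo (A k) 0, ∀ x, ‖v k t x‖ ≤ C / Real.sqrt (-t) := fun k t ht x =>
    (hv k).norm_le ht.2 x
  obtain ⟨φ, hφ, W, hW, hpt, -, -, -⟩ :=
    exists_tendsto_of_typeI_seq_Ioo C hAt hcont hdivw hmild hI
  -- the limit has concentration `≥ θ` at `(-1, 0)`
  have hW0 : θ ≤ ‖W (-1) 0‖ := by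
    refine ge_of_tendsto ((hpt (-1) (by norm_num) 0).norm) (Eventually.of_forall fun j => ?_)
    rw [hv0]
    exact hx (φ j)
  -- its slice at time `-L` vanishes identically
  have hWL : ∀ y, W (-L) y = 0 := by
    intro y
    have hconv : Tendsto (fun j => ‖v (φ j) (-L) y‖) atTop (𝓝 ‖W (-L) y‖) :=
      (hpt (-L) (by linarith) y).norm
    have hb : Tendsto (fun j : ℕ => 1 / ((φ j : ℝ) + 1)) atTop (𝓝 0) :=
      (tendsto_one_div_add_atTop_nhds_zero_nat (𝕜 := ℝ)).comp hφ.tendsto_atTop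
    -- `y` is eventually inside the growing balls `‖y‖ < φ j + 1`
    have hgrow : Tendsto (fun j : ℕ => (φ j : ℝ) + 1) atTop atTop :=
      (tendsto_natCast_atTop_atTop.comp hφ.tendsto_atTop).atTop_add tendsto_const_nhds
    have hev : ∀ᶠ j in atTop, ‖v (φ j) (-L) y‖ ≤ 1 / ((φ j : ℝ) + 1) := by
      filter_upwards [hgrow.eventually_gt_atTop ‖y‖] with j hj
      have hcpos : 0 < Real.sqrt (-t (φ j)) := Real.sqrt_pos.2 (neg_pos.2 (ht _))
      have hmem : x (φ j) + Real.sqrt (-t (φ j)) • y ∈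
          Metric.ball (x (φ j)) (((φ j : ℝ) + 1) * Real.sqrt (-t (φ j))) := by
        rw [Metric.mem_ball, dist_self_add_left, norm_smul, Real.norm_of_nonneg hcpos.le,
          mul_comm]
        exact mul_lt_mul_of_pos_right hj hcpos
      have hlt := hsmall (φ j) _ hmem
      have hsq : Real.sqrt (-(L * t (φ j))) = Real.sqrt L * Real.sqrt (-t (φ j)) := by
        rw [show -(L * t (φ j)) = L * (-t (φ j)) by ring, Real.sqrt_mul hL0.le]
      rw [hsq, mul_assoc] at hlt
      have h1L : 1 ≤ Real.sqrt L := Real.one_le_sqrt.2 hL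
      have hnn : 0 ≤ Real.sqrt (-t (φ j)) *
          ‖u (φ j) (L * t (φ j)) (x (φ j) + Real.sqrt (-t (φ j)) • y)‖ := by positivity
      rw [hvL]
      exact ((le_mul_of_one_le_left hnn h1L).trans_lt hlt).le
    exact norm_le_zero_iff.1 (le_of_tendsto_of_tendsto hconv hb hev)
  -- one zero slice kills the limit: contradiction with the concentration at `(-1, 0)`
  have hWz : W (-1) 0 = 0 :=
    sliceConstLiouville hW (by linarith : (-L : ℝ) < 0) (b := 0) hWL (-1) (by norm_num) 0
  rw [hWz, norm_zero] at hW0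
  exact absurd hW0 (not_le.2 hθ)

end BackwardPersistenceOfConcentration

/-- **Stub `stub_backwardPersistenceOfConcentration` (crux stmt-NavierStokesRegularity-10570, line
`registered`, dynamical structural law)**: BACKWARD PERSISTENCE OF VELOCITY CONCENTRATION in the
Type-I ancient mild class — for every `C`, `θ > 0` and time ratio `L ≥ 1` there are
`R = R(C, θ, L) > 0` and `θ' = θ'(C, θ, L) > 0` such that for every `u` with
`IsTypeIAncientMild C u`, every `t < 0` and every `x` with `√(−t)‖u(t, x)‖ ≥ θ` there is
`x' ∈ B(x, R√(−t))` with `√(−L t)‖u(L t, x')‖ ≥ θ'` (zoom + KNSS compactness at the fixed ratio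
`L` + one zero slice kills a class element; `backwardPersistenceOfConcentration`).
[cite: KochNadirashviliSereginSverak2009, Prop. 4.1 and Remark 6.1 (arXiv:0709.3599)] -/
theorem stub_backwardPersistenceOfConcentration : ∀ (C θ L : ℝ), 0 < θ → 1 ≤ L → ∃ R > 0, ∃ θ' > 0, ∀ u : ℝ → EuclideanSpace ℝ (Fin 3) → EuclideanSpace ℝ (Fin 3), Literature.Analysis.FluidPDE.IsTypeIAncientMild C u → ∀ t < 0, ∀ x : EuclideanSpace ℝ (Fin 3), θ ≤ Real.sqrt (-t) * ‖u t x‖ → ∃ x' ∈ Metric.ball x (R * Real.sqrt (-t)), θ' ≤ Real.sqrt (-(L * t)) * ‖u (L * t) x'‖ :=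
  fun C θ L hθ hL => backwardPersistenceOfConcentration C θ L hθ hL

end Summit.NavierStokesRegularity.NavierStokesRegularity.Theorems

end
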